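import Literature.AlgebraicGeometry.HodgeTheory.BettiPicardNumberBounds
import HarnessLib

/-!
# Hodge–Tate type and the Hodge conjecture: rational classes in the Lefschetz range are algebraic; for `dim X ≤ 3` all of `H^{ev}(X; ℚ)` is algebraic;
# for Hodge–Tate `X` the Hodge conjecture is exactly the algebraicity of `H^{2p}(X; ℚ)`, `2 ≤ p ≤ n − 2` (fourfolds: of `H⁴(X; ℚ)`);
# «all even rational cohomology algebraic» ⟺ «every `H^{2p}(X)` purely of type `(p,p)`» ∧ «Hodge conjecture for `X`»
# (Deligne §1; Voisin I Thm. 11.30, §11.3; Kerr–Pearlstein §3.1; Carlson–Müller-Stach–Peters Examples 3.4.5)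

Family `hodge`, lane `lit-hodgefound` (Track 2 foundations library; Layers A1/A4), layer `Literature/AlgebraicGeometry/HodgeTheory`.  THEOREMS ONLY (no definition,
no named fact, no instance; D-0026 net debt `0`; nothing is asserted about the conjecture itself — only equivalences for the tree's predicate `HodgeConjectureFor n X`).
The seat's g24-#6 (Hodge–Tate ⟹ `Hdgᵖ(H^{2p}(X)) = ⊤`), g24-#7 §5 (all classes algebraic ⟹ pure) and g24-#10 §2 (the Lefschetz-range dictionary Hodge classes =
rational algebraic classes, Lefschetz `(1,1)` + hard Lefschetz) COMBINED with the tree's `HodgeConjectureFor` (`HodgeTheory/HodgeConjecture`) and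
`isRationalClass_iff_mem_range_ofRatClass` (rational classes = image of `Hᵏ(X; ℚ)`):
* for `X` of Hodge–Tate type EVERY rational class of degree `2p` in the Lefschetz range (`p ≤ 1` or `p ≥ n − 1`) is algebraic, so for `dim X ≤ 3` ALL of
  `H^{ev}(X(ℂ); ℚ)` consists of algebraic classes (and `H^{odd} = 0`, g24-#6) — Hodge–Tate curves, surfaces (`p_g = q = 0`), threefolds (g24-#7 §4);
* for `X` of Hodge–Tate type **`HodgeConjectureFor n X ⟺` every class of `H^{2p}(X(ℂ); ℚ)`, `2 ≤ p ≤ n − 2`, is algebraic** — for a Hodge–Tate FOURFOLD exactly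
  **`H⁴(X; ℚ) ⊗ 1 ⊆ N²H⁴`**;
* for EVERY smooth projective `X`: **(∀ `p`, `H^{2p}(X; ℚ) ⊗ 1 ⊆ NᵖH^{2p}`) ⟺ (∀ `p`, `Hdgᵖ(H^{2p}(X)) = ⊤`) ∧ `HodgeConjectureFor n X`** (CMSP 3.4.5 (i) pattern: «all
  cohomology groups … are generated by classes of [algebraic cycles]»).

THE PRINTS.  P. Deligne (2000/2006) [Deligne2000] §1 (the statement: rational `(p,p)`-classes are algebraic).  C. Voisin (2002) [VoisinHodgeI2002] Thm. 11.30 (Lefschetz `(1,1)`), §11.3.1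
(Hodge classes, the conjecture), Thm. 6.25 (hard Lefschetz), §11.1.2 Prop. 11.20 (cycle classes are `(p,p)`).  M. Kerr, G. Pearlstein (2011) [KerrPearlstein2011] §3.1 (the conjecture
in the Lefschetz range / curve classes).  J. Carlson, S. Müller-Stach, C. Peters (2017) [CarlsonMullerStachPeters2017] §3.4 Examples 3.4.5 (p0118).  M. Green, P. Griffiths,
M. Kerr (2012) [GreenGriffithsKerr2012] §I.A p0033 (Hodge–Tate).

THE OBJECTS (all the tree's).  `X : SchemeOver ℂ`, `hX : IsSmoothProjective n X`, `hHD : exists_isReal_hodgeModel`; `H^{2p}(X) = BettiUniverse.hodge hHD hX (2 * p)` with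
`hodgeNumber`, `hodgeClasses`; `bettiCohomology`, `complexBetti`, `ofRatClass`, `IsRationalClass`, `IsOfHodgeType`, `algebraicClasses X p = NᵖH^{2p}`;
`HodgeConjectureFor n X`; `BettiUniverse.realHodgeModel` (a Hodge model, the non-vacuity conjunct of `HodgeConjectureFor`).

WHAT IS PROVED.
* §1 `BettiUniverse.ofRatClass_mem_algebraicClasses_of_hodgeTateType_of_lefschetzRange`, **`BettiUniverse.ofRatClass_mem_algebraicClasses_of_hodgeTateType_of_le_three`**
  (Hodge–Tate, `n ≤ 3`: every class of every `H^{2p}(X; ℚ)` is algebraic).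
* §2 **`BettiUniverse.hodgeConjectureFor_iff_of_hodgeTateType`** (Hodge–Tate: HC ⟺ algebraicity in `2 ≤ p ≤ n − 2`), `BettiUniverse.hodgeConjectureFor_of_hodgeTateType_of_le_three`,
  **`BettiUniverse.hodgeConjectureFor_iff_of_hodgeTateType_four`** (Hodge–Tate fourfolds: HC ⟺ `H⁴(X; ℚ)` algebraic), `BettiUniverse.hodgeConjectureFor_iff_of_hodgeTateType_five`.
* §3 EVERY `X`: **`BettiUniverse.forall_ofRatClass_mem_algebraicClasses_iff`** (all even rational cohomology algebraic ⟺ all `H^{2p}` pure ∧ HC),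
  `hodgeConjectureFor_of_forall_ofRatClass_mem_algebraicClasses` (model-free: the real Hodge model `exists_isReal_hodgeModel_holds` is supplied).

DEVIATIONS / SCOPE.  No case of the conjecture is proved here beyond the tree's Lefschetz range; §2–§3 are equivalences/reductions.

## References
* [Deligne2000] P. Deligne, *The Hodge conjecture*, Clay Mathematics Institute (2000/2006) — §1.
* [VoisinHodgeI2002] C. Voisin, *Hodge Theory and Complex Algebraic Geometry I* (2002) — Thm. 6.25, §11.1.2 Prop. 11.20, Thm. 11.30, §11.3.1.
* [KerrPearlstein2011] M. Kerr, G. Pearlstein (2011) — §3.1.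
* [CarlsonMullerStachPeters2017] J. Carlson, S. Müller-Stach, C. Peters, *Period Mappings and Period Domains*, 2nd ed. (2017) — §3.4 Examples 3.4.5 (p. 118).
* [GreenGriffithsKerr2012] M. Green, P. A. Griffiths, M. Kerr, *Mumford–Tate Groups and Domains* (2012) — §I.A p. 33.

## Provenance
Lane `lit-hodgefound` (Hodge path, Track 2), prover seat `lit-hodgefound-p29` (generation 24), self-proposed row g24-#15 (Hodge–Tate type versus the conjecture's predicate).
-/

noncomputable section

open scoped TensorProduct
open CategoryTheory Module
open Literature.AlgebraicTopology.SingularHomology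

namespace Literature.AlgebraicGeometry.HodgeTheory

open Literature.AlgebraicGeometry.Motives
open Literature.AlgebraicGeometry.Motives.HodgeStructure

variable {n : ℕ} {X : SchemeOver ℂ}

/-! ### §1 Hodge–Tate type: rational classes in the Lefschetz range are algebraic -/

/-- **For `X` of Hodge–Tate type every class of `H^{2p}(X(ℂ); ℚ)` with `p ≤ 1` or `p ≥ n − 1` is algebraic** (`Hdgᵖ = ⊤`, then Lefschetz `(1,1)` / hard Lefschetz).
[cite: VoisinHodgeI2002, Thm. 11.30 and Thm. 6.25] [cite: KerrPearlstein2011, §3.1] -/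
theorem BettiUniverse.ofRatClass_mem_algebraicClasses_of_hodgeTateType_of_lefschetzRange (hHD : exists_isReal_hodgeModel) (hX : IsSmoothProjective n X)
    (hHT : ∀ k p q : ℕ, p + q = k → p ≠ q → (BettiUniverse.hodge hHD hX k).hodgeNumber p q = 0) {p : ℕ} (hp : p ≤ 1 ∨ n ≤ p + 1)
    (v : bettiCohomology X (2 * p)) : ofRatClass (ComplexPoints X) (2 * p) v ∈ algebraicClasses X p :=
  (BettiUniverse.mem_hodgeClasses_hodge_iff_ofRatClass_mem_algebraicClasses hHD hX hp v).1
    (by rw [BettiUniverse.hodgeClasses_hodge_eq_top_of_hodgeTateType hHD hX hHT p]; exact Submodule.mem_top)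

/-- **Hodge–Tate type and `dim X ≤ 3`: EVERY class of EVERY `H^{2p}(X(ℂ); ℚ)` is algebraic** (all `p` are in the Lefschetz range; with g24-#6, `H^{odd}(X; ℚ) = 0`:
the rational cohomology of a Hodge–Tate curve, surface or threefold is spanned by algebraic cycle classes). [cite: VoisinHodgeI2002, Thm. 11.30 and Thm. 6.25]
[cite: KerrPearlstein2011, §3.1] [cite: CarlsonMullerStachPeters2017, §3.4 Examples 3.4.5 (p. 118)] -/
theorem BettiUniverse.ofRatClass_mem_algebraicClasses_of_hodgeTateType_of_le_three (hHD : exists_isReal_hodgeModel) (hX : IsSmoothProjective n X) (hn : n ≤ 3)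
    (hHT : ∀ k p q : ℕ, p + q = k → p ≠ q → (BettiUniverse.hodge hHD hX k).hodgeNumber p q = 0) (p : ℕ) (v : bettiCohomology X (2 * p)) :
    ofRatClass (ComplexPoints X) (2 * p) v ∈ algebraicClasses X p :=
  BettiUniverse.ofRatClass_mem_algebraicClasses_of_hodgeTateType_of_lefschetzRange hHD hX hHT (by omega) v

/-! ### §2 Hodge–Tate type: the conjecture's predicate is the algebraicity of the middle degrees -/

/-- **For `X` of Hodge–Tate type, `HodgeConjectureFor n X ⟺` every class of `H^{2p}(X(ℂ); ℚ)` with `2 ≤ p ≤ n − 2` is algebraic** (every rational class is a Hodge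
class; the Lefschetz range is unconditional; rational classes are the image of `H^{2p}(X; ℚ)`). [cite: Deligne2000, §1] [cite: VoisinHodgeI2002, §11.3.1 and Thm. 11.30]
[cite: KerrPearlstein2011, §3.1] -/
theorem BettiUniverse.hodgeConjectureFor_iff_of_hodgeTateType (hHD : exists_isReal_hodgeModel) (hX : IsSmoothProjective n X)
    (hHT : ∀ k p q : ℕ, p + q = k → p ≠ q → (BettiUniverse.hodge hHD hX k).hodgeNumber p q = 0) :
    HodgeConjectureFor n X ↔
      ∀ p : ℕ, 2 ≤ p → p + 2 ≤ n → ∀ v : bettiCohomology X (2 * p), ofRatClass (ComplexPoints X) (2 * p) v ∈ algebraicClasses X p := by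
  constructor
  · intro h p _ _ v
    exact h.2 p _ (isRationalClass_ofRatClass _) ((BettiUniverse.mem_hodgeClasses_hodge_iff_isOfHodgeType hHD hX p v).1
      (by rw [BettiUniverse.hodgeClasses_hodge_eq_top_of_hodgeTateType hHD hX hHT p]; exact Submodule.mem_top))
  · intro h
    refine ⟨⟨BettiUniverse.realHodgeModel hHD hX⟩, fun p c hc hpp => ?_⟩
    by_cases hp : p ≤ 1 ∨ n ≤ p + 1
    · exact mem_algebraicClasses_of_lefschetzRange_holds hX hp c hc hpp
    · obtain ⟨v, rfl⟩ := (isRationalClass_iff_mem_range_ofRatClass c).1 hc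
      exact h p (by omega) (by omega) v

/-- **Hodge–Tate type and `dim X ≤ 3` ⟹ `HodgeConjectureFor n X`** (no middle degree is left; the tree also has the conjecture for every `X` of dimension `≤ 3`,
`hodgeConjectureFor_of_dim_le_three_holds`). [cite: VoisinHodgeI2002, Thm. 11.30 and Thm. 6.25] [cite: KerrPearlstein2011, §3.1] -/
theorem BettiUniverse.hodgeConjectureFor_of_hodgeTateType_of_le_three (hHD : exists_isReal_hodgeModel) (hX : IsSmoothProjective n X) (hn : n ≤ 3)
    (hHT : ∀ k p q : ℕ, p + q = k → p ≠ q → (BettiUniverse.hodge hHD hX k).hodgeNumber p q = 0) : HodgeConjectureFor n X :=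
  (BettiUniverse.hodgeConjectureFor_iff_of_hodgeTateType hHD hX hHT).2 fun p hp2 hpn => by omega

/-- **Hodge–Tate FOURFOLDS: `HodgeConjectureFor 4 X ⟺ H⁴(X(ℂ); ℚ) ⊗ 1 ⊆ N²H⁴`** — the conjecture for a Hodge–Tate fourfold is exactly the algebraicity of its
rational degree-`4` cohomology. [cite: Deligne2000, §1] [cite: VoisinHodgeI2002, §11.3.1] -/
theorem BettiUniverse.hodgeConjectureFor_iff_of_hodgeTateType_four (hHD : exists_isReal_hodgeModel) (hX : IsSmoothProjective 4 X)
    (hHT : ∀ k p q : ℕ, p + q = k → p ≠ q → (BettiUniverse.hodge hHD hX k).hodgeNumber p q = 0) :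
    HodgeConjectureFor 4 X ↔ ∀ v : bettiCohomology X 4, ofRatClass (ComplexPoints X) 4 v ∈ algebraicClasses X 2 := by
  rw [BettiUniverse.hodgeConjectureFor_iff_of_hodgeTateType hHD hX hHT]
  refine ⟨fun h v => h 2 le_rfl le_rfl v, fun h p hp2 hp4 v => ?_⟩
  obtain rfl : p = 2 := by omega
  exact h v

/-- **Hodge–Tate FIVEFOLDS: `HodgeConjectureFor 5 X ⟺ H⁴(X; ℚ)` and `H⁶(X; ℚ)` consist of algebraic classes.** [cite: Deligne2000, §1] [cite: VoisinHodgeI2002, §11.3.1] -/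
theorem BettiUniverse.hodgeConjectureFor_iff_of_hodgeTateType_five (hHD : exists_isReal_hodgeModel) (hX : IsSmoothProjective 5 X)
    (hHT : ∀ k p q : ℕ, p + q = k → p ≠ q → (BettiUniverse.hodge hHD hX k).hodgeNumber p q = 0) :
    HodgeConjectureFor 5 X ↔
      (∀ v : bettiCohomology X 4, ofRatClass (ComplexPoints X) 4 v ∈ algebraicClasses X 2) ∧
        ∀ v : bettiCohomology X 6, ofRatClass (ComplexPoints X) 6 v ∈ algebraicClasses X 3 := by
  rw [BettiUniverse.hodgeConjectureFor_iff_of_hodgeTateType hHD hX hHT]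
  refine ⟨fun h => ⟨fun v => h 2 le_rfl (by norm_num) v, fun v => h 3 (by norm_num) le_rfl v⟩, fun h p hp2 hp5 v => ?_⟩
  rcases Nat.lt_or_ge p 3 with hp | hp
  · obtain rfl : p = 2 := by omega
    exact h.1 v
  · obtain rfl : p = 3 := by omega
    exact h.2 v

/-! ### §3 Every `X`: all even rational cohomology algebraic ⟺ pure even degrees ∧ the conjecture -/

/-- **For every smooth projective `X`: every class of every `H^{2p}(X(ℂ); ℚ)` is algebraic iff every `H^{2p}(X)` is purely of type `(p,p)` AND `HodgeConjectureFor n X`**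
(⟹: algebraic classes are `(p,p)`, g24-#7 §5, and rational classes are the image of `H^{2p}(X; ℚ)`; ⟸: every rational class is Hodge, and the conjecture).
[cite: VoisinHodgeI2002, §11.1.2 Prop. 11.20 and §11.3.1] [cite: Deligne2000, §1] [cite: CarlsonMullerStachPeters2017, §3.4 Examples 3.4.5 (p. 118)] -/
theorem BettiUniverse.forall_ofRatClass_mem_algebraicClasses_iff (hHD : exists_isReal_hodgeModel) (hX : IsSmoothProjective n X) :
    (∀ (p : ℕ) (v : bettiCohomology X (2 * p)), ofRatClass (ComplexPoints X) (2 * p) v ∈ algebraicClasses X p) ↔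
      (∀ p : ℕ, (BettiUniverse.hodge hHD hX (2 * p)).hodgeClasses p = ⊤) ∧ HodgeConjectureFor n X := by
  constructor
  · intro h
    refine ⟨fun p => BettiUniverse.hodgeClasses_hodge_eq_top_of_forall_mem_algebraicClasses hHD hX p (h p),
      ⟨BettiUniverse.realHodgeModel hHD hX⟩, fun p c hc _ => ?_⟩
    obtain ⟨v, rfl⟩ := (isRationalClass_iff_mem_range_ofRatClass c).1 hc
    exact h p v
  · rintro ⟨htop, hHC⟩ p v
    exact hHC.2 p _ (isRationalClass_ofRatClass _)
      ((BettiUniverse.mem_hodgeClasses_hodge_iff_isOfHodgeType hHD hX p v).1 (by rw [htop p]; exact Submodule.mem_top))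

/-- **If every class of every `H^{2p}(X(ℂ); ℚ)` is algebraic, then `HodgeConjectureFor n X`.** [cite: Deligne2000, §1] [cite: CarlsonMullerStachPeters2017, §3.4 Examples 3.4.5 (p. 118)] -/
theorem hodgeConjectureFor_of_forall_ofRatClass_mem_algebraicClasses (hX : IsSmoothProjective n X)
    (h : ∀ (p : ℕ) (v : bettiCohomology X (2 * p)), ofRatClass (ComplexPoints X) (2 * p) v ∈ algebraicClasses X p) : HodgeConjectureFor n X :=
  ((BettiUniverse.forall_ofRatClass_mem_algebraicClasses_iff exists_isReal_hodgeModel_holds hX).1 h).2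

end Literature.AlgebraicGeometry.HodgeTheory

end
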